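import Summits.Ventures.HSemireg.SiegelComponentChartAtGerm
import Summits.Ventures.HSemireg.SiegelComponentChartAt
import Summits.Ventures.HSemireg.SiegelComponentChartReducible
import Summits.Ventures.HSemireg.SiegelComponentChartSheaf
import HarnessLib

/-!
# Venture HSemireg — the cell's three object doors on `𝒜_{g,δ,N}` with the chart hypothesis AT ONE COMPONENT
# (red team 1, finding V4-T2: «localise so STEP-0 bets on the chart at ONE component»)

HONEST FRAMING. Assembly file of the computation cell `pub-hsemireg` (Lean seat p3, composition duty); nothing is claimed
about any variety and nothing here says that HC / HC_CM / HC_AV holds — every theorem carries its inputs BY NAME. No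
definition is declared in this file.

The landed 𝒜_g-forms of the cell's object doors — `hc_on_siegelComponent_of_unionSeed_of_smul_add` (D1′: REDUCED lci with
SMOOTH components; fact `BlochSemiregularSpreadSmoothComponents g p`), `hc_on_siegelComponent_of_subschemeSeed_of_smul_add`
(D1″: ANY lci; fact `BlochSemiregularSpreadOfSubscheme g p`) and `hc_on_siegelComponent_of_sheafSeed_of_smul_add` (D2:
`I`-semiregular vector bundle; fact `BuchweitzFlenner2003_variationalHodge_ISemiregular`) — take theory seat 3's chart
assumption `SiegelHodgeLocusChart g δ N` for EVERY `(D, p, C)` and use it once. Here are the same doors with theory seat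
3's chart hypothesis AT THEIR OWN COMPONENT only, `SiegelHodgeLocusChartAt D p C` (`SiegelComponentChartAt.lean`; the
`∃`-clause of `SiegelHodgeLocusChart` at `(D, p, C)`, `Iff.rfl`), and on theory seat 2's base chart at that component,
`SiegelHodgeLocusBaseChartAt D p C`, with `deligne_globalInvariantCycles` (through `siegelHodgeLocusChartAt_of_baseChartAt`).
D1′ and D1″ are instances of the door-agnostic `hc_on_siegelComponent_of_germ_of_smul_add_at`
(`SiegelComponentChartAtGerm.lean`; its chart clause is `SiegelHodgeLocusChartAt D p C` unfolded) at `hgerm :=` the named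
fact applied to the object; D2 re-runs the landed proof with `hA D p C` replaced by `hA` (companion Chern degrees do not
fit the one-class germ shape). The universal doors are recovered by `hA.chartAt D p C` / `hS.baseChartAt D p C`.

* `hc_on_siegelComponent_of_unionSeed_of_smul_add_at`, `…_of_baseChartAt`
* `hc_on_siegelComponent_of_subschemeSeed_of_smul_add_at`, `…_of_baseChartAt`
* `hc_on_siegelComponent_of_sheafSeed_of_smul_add_at`, `…_of_baseChartAt`

References: [Bloch1972Semiregularity] Thm. (7.4), Remark (7.5), p. 65; [BuchweitzFlenner2003] Thm. 5.1, Thm. 5.2;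
[CattaniDeligneKaplan1995JAMS] Thm. 1.1, Cor. 1.2; [DeligneHodgeII1971] Thm. 4.1.1; [Fulton1998] §1.5, §19.1.
-/

noncomputable section

open CategoryTheory AlgebraicGeometry Set
open Literature.AlgebraicGeometry.Motives Literature.AlgebraicGeometry.HodgeTheory
open Literature.AlgebraicGeometry.ModuliOfAbelianVarieties Literature.AlgebraicGeometry.Deligne1982
open Literature.AlgebraicTopology.SingularHomology

namespace Summit.Ventures.HSemireg

local notation3 (prettyPrint := false) "Res[" f ", " s ", " k ", " A "]" =>
  complexBetti.map (Literature.AlgebraicGeometry.Motives.fiberι f s) k A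

section Siegel

variable {g : ℕ} {δ : Fin g → ℕ} {N : ℕ}

/-! ## Door D1′ — reduced lci with smooth components -/

/-- **Door D1′ at one component** (the STEP-0 class (A) shape): as `hc_on_siegelComponent_of_unionSeed_of_smul_add` — on
`𝒴_{t₀}` (smooth projective of dimension `g`, witness `hX₀`) smooth projective `m`-folds `K_j ↪ 𝒴_{t₀}` (`m + p = g`,
pairwise distinct images) whose union carries a REDUCED Bloch-semiregular lci `Z` of codimension `p`, and
`a·α₀ + b·Λ|_{t₀} = μ·Σ_j ι_{j*}1` with `a, μ ∈ ℚ^×`, `Λ` global fibrewise rational `(p,p)` algebraic; fact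
`BlochSemiregularSpreadSmoothComponents g p` (Bloch (7.4)/(7.5), BF Thm. 5.2) — but with the chart hypothesis for THIS
component only, `SiegelHodgeLocusChartAt D p C`. Conclusion: `α` algebraic for EVERY `(t, α) ∈ C`.
[cite: Bloch1972Semiregularity, Thm. (7.4) and Remark (7.5), p. 65] [cite: BuchweitzFlenner2003, Thm. 5.2]
[cite: CattaniDeligneKaplan1995JAMS, Thm. 1.1 and Cor. 1.2] -/
theorem hc_on_siegelComponent_of_unionSeed_of_smul_add_at {p : ℕ} {D : SiegelModuliDatum g δ N}
    {C : HodgeLocusComponent D.f g p} (hA : SiegelHodgeLocusChartAt D p C)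
    (hB : BlochSemiregularSpreadSmoothComponents g p)
    (Λ : complexBetti D.𝒳 (2 * p))
    (hΛ : ∀ s : ComplexPoints D.S, IsRationalClass (Res[D.f, s, 2 * p, Λ]) ∧
      IsOfHodgeType g (fiberOver D.f s) (2 * p) p p (Res[D.f, s, 2 * p, Λ]))
    (hΛalg : ∀ s : ComplexPoints D.S, Res[D.f, s, 2 * p, Λ] ∈ algebraicClasses (fiberOver D.f s) p)
    {x₀ : FiberClass D.f (2 * p)} (hx₀ : x₀ ∈ C.carrier) (a b : ℚ) (ha : a ≠ 0)
    (hX₀ : IsSmoothProjective g (fiberOver D.f x₀.pt)) {m : ℕ} (hmn : m + p = g)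
    {r : ℕ} (K : Fin r → SchemeOver ℂ) (hK : ∀ j, IsSmoothProjective m (K j)) (ι : ∀ j, K j ⟶ fiberOver D.f x₀.pt)
    (hι : ∀ j, IsClosedImmersion (ι j).left)
    (hdist : ∀ j j', Set.range (ι j).left.base = Set.range (ι j').left.base → j = j')
    {Z : Scheme.{0}} (i : Z ⟶ (fiberOver D.f x₀.pt).left) (hreg : IsRegularImmersionOfCodim i p) (hred : IsReduced Z)
    (hrange : Set.range i.base = ⋃ j, Set.range (ι j).left.base) (hsr : IsBlochSemiregular i g p) (μ : ℚ) (hμ : μ ≠ 0)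
    (hcls : (a : ℂ) • x₀.cls + (b : ℂ) • Res[D.f, x₀.pt, 2 * p, Λ] =
      ((μ : ℚ) : ℂ) • ∑ j, smoothSubvarietyClass hmn (hK j) hX₀ (ι j)) :
    ∀ x ∈ C.carrier, x.cls ∈ algebraicClasses (fiberOver D.f x.pt) p :=
  hc_on_siegelComponent_of_germ_of_smul_add_at hA Λ hΛ hΛalg hx₀ a b ha _ μ hμ hcls
    fun 𝒳 T f u₀ e V hf h𝒳 hT hTs hV hVx =>
      hB m hmn (fiberOver D.f x₀.pt) hX₀ r K hK ι Z i 𝒳 T f u₀ e V hι hdist hreg hred hrange hsr hf h𝒳 hT hTs hV hVx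

/-- **Door D1′ on base-chart data at the component** (`SiegelHodgeLocusBaseChartAt D p C`) **and Deligne's
théorème de la partie fixe**, through theory seat 3's `siegelHodgeLocusChartAt_of_baseChartAt`.
[cite: Bloch1972Semiregularity, Thm. (7.4) and Remark (7.5), p. 65] [cite: DeligneHodgeII1971, Théorème 4.1.1]
[cite: MoonenOort2013Torelli, §3 Def. (Version 2) and (d)] -/
theorem hc_on_siegelComponent_of_unionSeed_of_smul_add_of_baseChartAt {p : ℕ} {D : SiegelModuliDatum g δ N}
    {C : HodgeLocusComponent D.f g p} (hS : SiegelHodgeLocusBaseChartAt D p C)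
    (hGIC : deligne_globalInvariantCycles) (hB : BlochSemiregularSpreadSmoothComponents g p)
    (Λ : complexBetti D.𝒳 (2 * p))
    (hΛ : ∀ s : ComplexPoints D.S, IsRationalClass (Res[D.f, s, 2 * p, Λ]) ∧
      IsOfHodgeType g (fiberOver D.f s) (2 * p) p p (Res[D.f, s, 2 * p, Λ]))
    (hΛalg : ∀ s : ComplexPoints D.S, Res[D.f, s, 2 * p, Λ] ∈ algebraicClasses (fiberOver D.f s) p)
    {x₀ : FiberClass D.f (2 * p)} (hx₀ : x₀ ∈ C.carrier) (a b : ℚ) (ha : a ≠ 0)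
    (hX₀ : IsSmoothProjective g (fiberOver D.f x₀.pt)) {m : ℕ} (hmn : m + p = g)
    {r : ℕ} (K : Fin r → SchemeOver ℂ) (hK : ∀ j, IsSmoothProjective m (K j)) (ι : ∀ j, K j ⟶ fiberOver D.f x₀.pt)
    (hι : ∀ j, IsClosedImmersion (ι j).left)
    (hdist : ∀ j j', Set.range (ι j).left.base = Set.range (ι j').left.base → j = j')
    {Z : Scheme.{0}} (i : Z ⟶ (fiberOver D.f x₀.pt).left) (hreg : IsRegularImmersionOfCodim i p) (hred : IsReduced Z)
    (hrange : Set.range i.base = ⋃ j, Set.range (ι j).left.base) (hsr : IsBlochSemiregular i g p) (μ : ℚ) (hμ : μ ≠ 0)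
    (hcls : (a : ℂ) • x₀.cls + (b : ℂ) • Res[D.f, x₀.pt, 2 * p, Λ] =
      ((μ : ℚ) : ℂ) • ∑ j, smoothSubvarietyClass hmn (hK j) hX₀ (ι j)) :
    ∀ x ∈ C.carrier, x.cls ∈ algebraicClasses (fiberOver D.f x.pt) p :=
  hc_on_siegelComponent_of_unionSeed_of_smul_add_at (siegelHodgeLocusChartAt_of_baseChartAt hS hGIC) hB Λ hΛ hΛalg hx₀ a b
    ha hX₀ hmn K hK ι hι hdist i hreg hred hrange hsr μ hμ hcls

/-! ## Door D1″ — arbitrary lci subscheme -/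

/-- **Door D1″ at one component** (the Prong-C shape: singular components, multiplicities): as
`hc_on_siegelComponent_of_subschemeSeed_of_smul_add` — a closed lci `i : Z ↪ 𝒴_{t₀}` of codimension `p` (`Z` locally
Noetherian, pure, `[Z] ∈ Z_d(𝒴_{t₀})`, `d + p = g`), Bloch-semiregular, with `a·α₀ + b·Λ|_{t₀} = μ·[Z]`, `[Z]` the REAL
fundamental class `subschemeClass hX₀ hdp ρ i hi`, `a, μ ∈ ℚ^×`; fact `BlochSemiregularSpreadOfSubscheme g p` (Bloch
(7.4)/BF Thm. 5.2 for any lci, literature seat lit-1) — with the chart hypothesis for THIS component only,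
`SiegelHodgeLocusChartAt D p C`. Conclusion: `α` algebraic for EVERY `(t, α) ∈ C`.
[cite: Bloch1972Semiregularity, Thm. (7.4) and Remark (7.5), p. 65] [cite: BuchweitzFlenner2003, Thm. 5.2]
[cite: Fulton1998, §1.5 and §19.1] [cite: CattaniDeligneKaplan1995JAMS, Thm. 1.1 and Cor. 1.2] -/
theorem hc_on_siegelComponent_of_subschemeSeed_of_smul_add_at {p : ℕ} {D : SiegelModuliDatum g δ N}
    {C : HodgeLocusComponent D.f g p} (hA : SiegelHodgeLocusChartAt D p C)
    (hB : BlochSemiregularSpreadOfSubscheme g p)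
    (Λ : complexBetti D.𝒳 (2 * p))
    (hΛ : ∀ s : ComplexPoints D.S, IsRationalClass (Res[D.f, s, 2 * p, Λ]) ∧
      IsOfHodgeType g (fiberOver D.f s) (2 * p) p p (Res[D.f, s, 2 * p, Λ]))
    (hΛalg : ∀ s : ComplexPoints D.S, Res[D.f, s, 2 * p, Λ] ∈ algebraicClasses (fiberOver D.f s) p)
    {x₀ : FiberClass D.f (2 * p)} (hx₀ : x₀ ∈ C.carrier) (a b : ℚ) (ha : a ≠ 0)
    (hX₀ : IsSmoothProjective g (fiberOver D.f x₀.pt)) {d : ℕ} (hdp : d + p = g)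
    (ρ : ResolutionFamily (fiberOver D.f x₀.pt) d)
    {Z : Scheme.{0}} (i : Z ⟶ (fiberOver D.f x₀.pt).left) [IsLocallyNoetherian Z] (hi : IsClosedImmersion i)
    (hreg : IsRegularImmersionOfCodim i p) (hcodim : ∀ z ∈ Set.range i.base, (p : ℕ∞) ≤ Order.coheight z)
    (hsr : IsBlochSemiregular i g p) (hmem : subschemeCycle i hi ∈ cyclesOfDim (fiberOver D.f x₀.pt).left d)
    (μ : ℚ) (hμ : μ ≠ 0)
    (hcls : (a : ℂ) • x₀.cls + (b : ℂ) • Res[D.f, x₀.pt, 2 * p, Λ] =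
      ((μ : ℚ) : ℂ) • subschemeClass hX₀ hdp ρ i hi) :
    ∀ x ∈ C.carrier, x.cls ∈ algebraicClasses (fiberOver D.f x.pt) p :=
  hc_on_siegelComponent_of_germ_of_smul_add_at hA Λ hΛ hΛalg hx₀ a b ha _ μ hμ hcls
    fun 𝒳 T f u₀ e V hf h𝒳 hT hTs hV hVx =>
      hB (fiberOver D.f x₀.pt) Z i (subschemeClass hX₀ hdp ρ i hi) 𝒳 T f u₀ e V hX₀ d hdp ρ hi hreg hcodim hsr hmem rfl
        hf h𝒳 hT hTs hV hVx

/-- **Door D1″ on base-chart data at the component** (`SiegelHodgeLocusBaseChartAt D p C`) **and Deligne's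
théorème de la partie fixe**, through theory seat 3's `siegelHodgeLocusChartAt_of_baseChartAt`.
[cite: Bloch1972Semiregularity, Thm. (7.4) and Remark (7.5), p. 65] [cite: DeligneHodgeII1971, Théorème 4.1.1]
[cite: MoonenOort2013Torelli, §3 Def. (Version 2) and (d)] -/
theorem hc_on_siegelComponent_of_subschemeSeed_of_smul_add_of_baseChartAt {p : ℕ} {D : SiegelModuliDatum g δ N}
    {C : HodgeLocusComponent D.f g p} (hS : SiegelHodgeLocusBaseChartAt D p C)
    (hGIC : deligne_globalInvariantCycles) (hB : BlochSemiregularSpreadOfSubscheme g p)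
    (Λ : complexBetti D.𝒳 (2 * p))
    (hΛ : ∀ s : ComplexPoints D.S, IsRationalClass (Res[D.f, s, 2 * p, Λ]) ∧
      IsOfHodgeType g (fiberOver D.f s) (2 * p) p p (Res[D.f, s, 2 * p, Λ]))
    (hΛalg : ∀ s : ComplexPoints D.S, Res[D.f, s, 2 * p, Λ] ∈ algebraicClasses (fiberOver D.f s) p)
    {x₀ : FiberClass D.f (2 * p)} (hx₀ : x₀ ∈ C.carrier) (a b : ℚ) (ha : a ≠ 0)
    (hX₀ : IsSmoothProjective g (fiberOver D.f x₀.pt)) {d : ℕ} (hdp : d + p = g)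
    (ρ : ResolutionFamily (fiberOver D.f x₀.pt) d)
    {Z : Scheme.{0}} (i : Z ⟶ (fiberOver D.f x₀.pt).left) [IsLocallyNoetherian Z] (hi : IsClosedImmersion i)
    (hreg : IsRegularImmersionOfCodim i p) (hcodim : ∀ z ∈ Set.range i.base, (p : ℕ∞) ≤ Order.coheight z)
    (hsr : IsBlochSemiregular i g p) (hmem : subschemeCycle i hi ∈ cyclesOfDim (fiberOver D.f x₀.pt).left d)
    (μ : ℚ) (hμ : μ ≠ 0)
    (hcls : (a : ℂ) • x₀.cls + (b : ℂ) • Res[D.f, x₀.pt, 2 * p, Λ] =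
      ((μ : ℚ) : ℂ) • subschemeClass hX₀ hdp ρ i hi) :
    ∀ x ∈ C.carrier, x.cls ∈ algebraicClasses (fiberOver D.f x.pt) p :=
  hc_on_siegelComponent_of_subschemeSeed_of_smul_add_at (siegelHodgeLocusChartAt_of_baseChartAt hS hGIC) hB Λ hΛ hΛalg
    hx₀ a b ha hX₀ hdp ρ i hi hreg hcodim hsr hmem μ hμ hcls

/-! ## Door D2 — `I`-semiregular vector bundle -/

/-- **Door D2 at one component** (Buchweitz–Flenner): as `hc_on_siegelComponent_of_sheafSeed_of_smul_add` — a Chern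
character theory `Cc`, a finite `I ∋ p`, global classes `Λ_{p'}` of the universal family fibrewise `(p',p')` for
`p' ∈ I` with `Λ_p` moreover fibrewise rational and algebraic, `(t₀, α₀) ∈ C`, rationals `a ≠ 0`, `b`, `c_{p'}`, and on
EVERY model `e : X₀ ≅ 𝒴_{t₀}` a finite locally free `I`-semiregular `ℰ₀` with `ch_p(ℰ₀) = e^*(a·α₀ + b·Λ_p|_{t₀})`,
`ch_{p'}(ℰ₀) = e^*(c_{p'}·Λ_{p'}|_{t₀})` (`p' ∈ I ∖ {p}`); fact `BuchweitzFlenner2003_variationalHodge_ISemiregular` (BF Thm.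
5.1) — with the chart hypothesis for THIS component only, `SiegelHodgeLocusChartAt D p C`. Conclusion: `α`
algebraic for EVERY `(t, α) ∈ C`. Proof: the landed one with `hA D p C` replaced by `hA`.
[cite: BuchweitzFlenner2003, §5 Thm. 5.1] [cite: CattaniDeligneKaplan1995JAMS, Thm. 1.1 and Cor. 1.2]
[cite: Markman2025SecantWeil, §1.5] -/
theorem hc_on_siegelComponent_of_sheafSeed_of_smul_add_at {p : ℕ} {D : SiegelModuliDatum g δ N}
    {C : HodgeLocusComponent D.f g p} (hA : SiegelHodgeLocusChartAt D p C)
    (hBF : BuchweitzFlenner2003_variationalHodge_ISemiregular) (Cc : ChernCharacterBetti)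
    (I : Finset ℕ) (hp : p ∈ I)
    (Λ : (p' : ℕ) → complexBetti D.𝒳 (2 * p'))
    (hΛ : ∀ p' ∈ I, ∀ s : ComplexPoints D.S, IsOfHodgeType g (fiberOver D.f s) (2 * p') p' p' (Res[D.f, s, 2 * p', Λ p']))
    (hΛp : ∀ s : ComplexPoints D.S, IsRationalClass (Res[D.f, s, 2 * p, Λ p]) ∧
      Res[D.f, s, 2 * p, Λ p] ∈ algebraicClasses (fiberOver D.f s) p)
    {x₀ : FiberClass D.f (2 * p)} (hx₀ : x₀ ∈ C.carrier) (a b : ℚ) (ha : a ≠ 0) (c : ℕ → ℚ)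
    (hseed : ∀ (X₀ : SchemeOver ℂ) (e : X₀ ≅ fiberOver D.f x₀.pt),
      ∃ (E₀ : X₀.left.Modules) (hE₀ : IsFiniteLocallyFree E₀), IsISemiregular hE₀ {q | q + 1 ∈ I} ∧
        Cc.ch X₀ E₀ p = complexBetti.map e.hom (2 * p) ((a : ℂ) • x₀.cls + (b : ℂ) • Res[D.f, x₀.pt, 2 * p, Λ p]) ∧
        ∀ p' ∈ I, p' ≠ p →
          Cc.ch X₀ E₀ p' = complexBetti.map e.hom (2 * p') (((c p' : ℚ) : ℂ) • Res[D.f, x₀.pt, 2 * p', Λ p'])) :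
    ∀ x ∈ C.carrier, x.cls ∈ algebraicClasses (fiberOver D.f x.pt) p := by
  obtain ⟨𝒳, T, f, Φ, W, hf, h𝒳, hT, hTs, hTi, hW, hΦ, hsw⟩ := hA
  haveI := hTi
  -- the pulled-back companion classes `L_{p'} = Φ^*Λ_{p'}`: fibrewise `(p',p')`, and `L_p` algebraic on every chart fibre
  have hLfib : ∀ p' ∈ I, ∀ u : ComplexPoints T,
      IsOfHodgeType g (fiberOver f u) (2 * p') p' p' (Res[f, u, 2 * p', complexBetti.map Φ (2 * p') (Λ p')]) := by
    intro p' hp' u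
    obtain ⟨s, e, he⟩ := hΦ u
    rw [← map_res_eq_res_map_of_comm e he]
    exact (isOfHodgeType_map_iff_of_iso e).2 (hΛ p' hp' s)
  have hLalg : ∀ u : ComplexPoints T,
      Res[f, u, 2 * p, complexBetti.map Φ (2 * p) (Λ p)] ∈ algebraicClasses (fiberOver f u) p := by
    intro u
    obtain ⟨s, e, he⟩ := hΦ u
    rw [← map_res_eq_res_map_of_comm e he]
    exact (mem_algebraicClasses_map_iff_of_iso e).2 (hΛp s).2
  -- the special point on the chart and the sheaf seed on the chart fibre
  obtain ⟨u₀, e₀, he₀Φ, he₀⟩ := hsw x₀ hx₀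
  obtain ⟨E₀, hE₀, hsr, hchp, hchp'⟩ := hseed (fiberOver f u₀) e₀
  -- the global classes of the chart in the degrees `p' ∈ I`
  let Wfam : (p' : ℕ) → complexBetti 𝒳 (2 * p') :=
    Function.update (fun p' => ((c p' : ℚ) : ℂ) • complexBetti.map Φ (2 * p') (Λ p')) p
      ((a : ℂ) • W + (b : ℂ) • complexBetti.map Φ (2 * p) (Λ p))
  have hWp : Wfam p = (a : ℂ) • W + (b : ℂ) • complexBetti.map Φ (2 * p) (Λ p) := Function.update_self _ _ _
  have hWne : ∀ p', p' ≠ p → Wfam p' = ((c p' : ℚ) : ℂ) • complexBetti.map Φ (2 * p') (Λ p') :=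
    fun p' hne => Function.update_of_ne hne _ _
  have hWhodge : ∀ p' ∈ I, ∀ u : ComplexPoints T,
      IsOfHodgeType g (fiberOver f u) (2 * p') p' p' (Res[f, u, 2 * p', Wfam p']) := by
    intro p' hp' u
    rcases eq_or_ne p' p with rfl | hne
    · rw [hWp, map_add, map_smul, map_smul]
      exact ((hW u).2.smul (a : ℂ)).add (hf.isSmoothProjective u) ((hLfib p' hp u).smul (b : ℂ))
    · rw [hWne p' hne, map_smul]
      exact (hLfib p' hp' u).smul _
  have hW₀ : ∀ p' ∈ I, Res[f, u₀, 2 * p', Wfam p'] = Cc.ch (fiberOver f u₀) E₀ p' := by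
    intro p' hp'
    rcases eq_or_ne p' p with rfl | hne
    · rw [hWp, map_add, map_smul, map_smul, hchp, map_add, map_smul, map_smul, he₀, map_res_eq_res_map_of_comm e₀ he₀Φ]
    · rw [hWne p' hne, map_smul, hchp' p' hp' hne, map_smul, map_res_eq_res_map_of_comm e₀ he₀Φ]
  have hsweep : SweepsClasses D.f f W C.carrier := fun x hx => by
    obtain ⟨u, e, -, he⟩ := hsw x hx
    exact ⟨u, e, he⟩
  exact forall_mem_algebraicClasses_of_sweepsClasses_sheaf_of_smul_add hBF Cc hf h𝒳 hT hTs u₀ E₀ hE₀ I hsr Wfam hWhodge hW₀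
    hp W (complexBetti.map Φ (2 * p) (Λ p)) a b ha hWp hLalg hsweep

/-- **Door D2 on base-chart data at the component** (`SiegelHodgeLocusBaseChartAt D p C`) **and Deligne's théorème
de la partie fixe**, through theory seat 3's `siegelHodgeLocusChartAt_of_baseChartAt`. [cite: BuchweitzFlenner2003, §5 Thm. 5.1]
[cite: DeligneHodgeII1971, Théorème 4.1.1] [cite: MoonenOort2013Torelli, §3 Def. (Version 2) and (d)] -/
theorem hc_on_siegelComponent_of_sheafSeed_of_smul_add_of_baseChartAt {p : ℕ} {D : SiegelModuliDatum g δ N}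
    {C : HodgeLocusComponent D.f g p} (hS : SiegelHodgeLocusBaseChartAt D p C)
    (hGIC : deligne_globalInvariantCycles)
    (hBF : BuchweitzFlenner2003_variationalHodge_ISemiregular) (Cc : ChernCharacterBetti)
    (I : Finset ℕ) (hp : p ∈ I)
    (Λ : (p' : ℕ) → complexBetti D.𝒳 (2 * p'))
    (hΛ : ∀ p' ∈ I, ∀ s : ComplexPoints D.S, IsOfHodgeType g (fiberOver D.f s) (2 * p') p' p' (Res[D.f, s, 2 * p', Λ p']))
    (hΛp : ∀ s : ComplexPoints D.S, IsRationalClass (Res[D.f, s, 2 * p, Λ p]) ∧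
      Res[D.f, s, 2 * p, Λ p] ∈ algebraicClasses (fiberOver D.f s) p)
    {x₀ : FiberClass D.f (2 * p)} (hx₀ : x₀ ∈ C.carrier) (a b : ℚ) (ha : a ≠ 0) (c : ℕ → ℚ)
    (hseed : ∀ (X₀ : SchemeOver ℂ) (e : X₀ ≅ fiberOver D.f x₀.pt),
      ∃ (E₀ : X₀.left.Modules) (hE₀ : IsFiniteLocallyFree E₀), IsISemiregular hE₀ {q | q + 1 ∈ I} ∧
        Cc.ch X₀ E₀ p = complexBetti.map e.hom (2 * p) ((a : ℂ) • x₀.cls + (b : ℂ) • Res[D.f, x₀.pt, 2 * p, Λ p]) ∧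
        ∀ p' ∈ I, p' ≠ p →
          Cc.ch X₀ E₀ p' = complexBetti.map e.hom (2 * p') (((c p' : ℚ) : ℂ) • Res[D.f, x₀.pt, 2 * p', Λ p'])) :
    ∀ x ∈ C.carrier, x.cls ∈ algebraicClasses (fiberOver D.f x.pt) p :=
  hc_on_siegelComponent_of_sheafSeed_of_smul_add_at (siegelHodgeLocusChartAt_of_baseChartAt hS hGIC) hBF Cc I hp Λ hΛ hΛp
    hx₀ a b ha c hseed

end Siegel

end Summit.Ventures.HSemireg

end
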